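import Summits.KontsevichZagierPeriods.KontsevichZagierPeriods.Theses.IsogenyCertificates
import Literature.NumberTheory.Transcendental.KZSubcalculusInvariants
import Literature.NumberTheory.Transcendental.SemialgebraicMapsProofs

/-!
# `RealPeriodSectorComplete` (stmt-KontsevichZagierPeriods-5381) — negative knowledge, part 0: the sector's data and one explicit inhabitant

Support file for the crux `IsogenyCertificates.RealPeriodSectorComplete` (cdisprove seat, gen 1;
work file `Cruxes/RealPeriodSectorComplete/Disproof.lean`). The crux is an instance family of the
summit (Kontsevich–Zagier 2001, §1.2 Conjecture 1) on the sector of real periods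
`∫_{P>0} dx/√P`, `P = x³ + Ax + B` nonsingular over `ℤ`. This part supplies the sector's data as
reusable lemmas — `dom A B = {P > 0}` is `ℚ`-semialgebraic (`isSemialgebraic_dom`),
`integrand A B a = a/√P` is a `ℚ`-semialgebraic function on it for EVERY rational `a`
(`isSemialgebraicFunOn_integrand`, via `a/√P = a·√P·(1/P)` and the tree's Tarski–Seidenberg
discharges), `{P > 0}` contains the ray `x > |A|+|B|+1` (`cubic_pos_of_lt`) — and ONE explicit
inhabitant of the crux's hypotheses: `fermatRep a = [{x³−1>0}, a/√(x³−1)]`, the real-sector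
representation of the Fermat cubic `y² = x³ − 1` (integrability proved as for the tree's Tunnell
period), with `value = a·ϖ₃`, `ϖ₃ = ∫₁^∞ dt/√(t³−1) > 0`. So the crux is NOT vacuous.
[cite: KontsevichZagier2001, §1.2 Conjecture 1]
-/

noncomputable section

open MeasureTheory Set Filter MvPolynomial
open Literature.ModelTheory.ExponentialFields (IsSemialgebraic isSemialgebraic_setOf_eval_pos
  isSemialgebraic_setOf_eval_eq_zero)
open Literature.NumberTheory.Transcendental
open Literature.NumberTheory.Transcendental.KZ

namespace Summit.KontsevichZagierPeriods.IsogenyCertificates.RealPeriodSectorCompleteNegative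

open Summit.KontsevichZagierPeriods.KontsevichZagierPeriods.Theses.IsogenyCertificates
  (RealPeriodSectorComplete)

/-! ## §1 The data of the crux: domain `{P > 0}`, integrand `a/√P`, and one explicit inhabitant -/

/-- The real-locus domain `{x | P(x) > 0}` of the crux, `P = x³ + A x + B`. -/
def dom (A B : ℤ) : Set (Fin 1 → ℝ) := {x | 0 < x 0 ^ 3 + (A : ℝ) * x 0 + (B : ℝ)}

/-- The crux integrand `a / √P`. -/
def integrand (A B : ℤ) (a : ℚ) (x : Fin 1 → ℝ) : ℝ :=
  (a : ℝ) / Real.sqrt (x 0 ^ 3 + (A : ℝ) * x 0 + (B : ℝ))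

/-- `P` as a polynomial over `ℚ`. -/
def cubicPoly (A B : ℤ) : MvPolynomial (Fin 1) ℚ := X 0 ^ 3 + C (A : ℚ) * X 0 + C (B : ℚ)

/-- Evaluation of `cubicPoly`. [folklore] -/
theorem aeval_cubicPoly (A B : ℤ) (x : Fin 1 → ℝ) :
    aeval x (cubicPoly A B) = x 0 ^ 3 + (A : ℝ) * x 0 + (B : ℝ) := by
  simp [cubicPoly, map_add, map_mul, map_pow]

/-- `{P > 0}` is `ℚ`-semialgebraic. [folklore] -/
theorem isSemialgebraic_dom (A B : ℤ) : IsSemialgebraic ℚ (dom A B) := by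
  convert isSemialgebraic_setOf_eval_pos (R := ℝ) (cubicPoly A B) using 1
  ext x
  simp [dom, aeval_cubicPoly]

/-- `a/√P` is a `ℚ`-semialgebraic function on `{P > 0}` (for every rational `a`, any sign):
`a/√P = a · √P · (1/P)` there. [folklore] -/
theorem isSemialgebraicFunOn_integrand (A B : ℤ) (a : ℚ) :
    IsSemialgebraicFunOn ℚ (dom A B) (integrand A B a) := by
  have hs := isSemialgebraic_dom A B
  have hP : ∀ x ∈ dom A B, aeval x (cubicPoly A B) ≠ 0 := fun x hx => by
    rw [aeval_cubicPoly]; exact (ne_of_gt hx)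
  have ha : IsAlgebraic ℚ ((a : ℚ) : ℝ) := by
    simpa using isAlgebraic_algebraMap (R := ℚ) (A := ℝ) a
  have h1 : IsSemialgebraicFunOn ℚ (dom A B) (fun _ => ((a : ℚ) : ℝ)) :=
    isSemialgebraicFunOn_const_of_isAlgebraic hs ha
  have h2 : IsSemialgebraicFunOn ℚ (dom A B) (fun x => Real.sqrt (aeval x (cubicPoly A B))) :=
    IsSemialgebraicFunOn.sqrt_holds (isSemialgebraicFunOn_aeval hs (cubicPoly A B))
  have h3 : IsSemialgebraicFunOn ℚ (dom A B)
      (fun x => aeval x (1 : MvPolynomial (Fin 1) ℚ) / aeval x (cubicPoly A B)) :=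
    isSemialgebraicFunOn_aeval_div_aeval hs 1 (cubicPoly A B) hP
  have h4 := IsSemialgebraicFunOn.mul_holds h1 (IsSemialgebraicFunOn.mul_holds h2 h3)
  refine h4.congr (fun x hx => ?_)
  have hx' : 0 < x 0 ^ 3 + (A : ℝ) * x 0 + (B : ℝ) := hx
  have hsq : 0 < Real.sqrt (x 0 ^ 3 + (A : ℝ) * x 0 + (B : ℝ)) := Real.sqrt_pos.2 hx'
  simp only [Pi.mul_apply, integrand, aeval_cubicPoly, map_one]
  rw [one_div, ← div_eq_mul_inv, Real.sqrt_div_self, div_eq_mul_inv]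

/-- For `t > |A| + |B| + 1` the cubic is positive: `{P > 0}` contains a ray. [folklore] -/
theorem cubic_pos_of_lt (A B : ℤ) {t : ℝ} (ht : |(A : ℝ)| + |(B : ℝ)| + 1 < t) :
    0 < t ^ 3 + (A : ℝ) * t + (B : ℝ) := by
  have hA0 : 0 ≤ |(A : ℝ)| := abs_nonneg _
  have hB0 : 0 ≤ |(B : ℝ)| := abs_nonneg _
  have ht1 : 1 < t := by linarith
  have ht0 : 0 < t := by linarith
  have hA : -(|(A : ℝ)| * t) ≤ (A : ℝ) * t := by
    have := neg_abs_le (A : ℝ)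
    nlinarith
  have hB : -|(B : ℝ)| ≤ (B : ℝ) := neg_abs_le _
  have h2 : t ≤ t ^ 2 := by nlinarith
  have h3 : |(B : ℝ)| + 1 < t ^ 2 - |(A : ℝ)| := by linarith
  have h4 : (|(B : ℝ)| + 1) * t < (t ^ 2 - |(A : ℝ)|) * t := by nlinarith
  nlinarith

/-! ### The explicit inhabitant: the Fermat cubic `y² = x³ − 1` (`(A, B) = (0, −1)`, `Δ`-condition `27 ≠ 0`) -/

/-- `ϖ₃ := ∫₁^∞ dt/√(t³ − 1)` (`= B(1/2, 1/6)/3 = 2.4286506…`), the real-sector period of `y² = x³ − 1`. -/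
def fermatPeriod : ℝ := ∫ t in Ioi (1 : ℝ), (Real.sqrt (t ^ 3 - 1))⁻¹

/-- `t³ − 1 > 0` for `t > 1`. [folklore] -/
theorem cube_sub_one_pos {t : ℝ} (ht : 1 < t) : 0 < t ^ 3 - 1 := by
  have h1 : 1 < t ^ 2 := by nlinarith
  nlinarith

/-- `t − 1 ≤ t³ − 1` for `t ≥ 1`. [folklore] -/
theorem sub_one_le_cube_sub_one {t : ℝ} (ht : 1 ≤ t) : t - 1 ≤ t ^ 3 - 1 := by
  have h : 0 ≤ t * (t - 1) * (t + 1) :=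
    mul_nonneg (mul_nonneg (by linarith) (by linarith)) (by linarith)
  nlinarith [h]

/-- `t³/2 ≤ t³ − 1` for `t ≥ 2`. [folklore] -/
theorem half_cube_le_cube_sub_one {t : ℝ} (ht : 2 ≤ t) : t ^ 3 / 2 ≤ t ^ 3 - 1 := by
  have h4 : 4 ≤ t ^ 2 := by nlinarith
  have h8 : 8 ≤ t ^ 3 := by nlinarith
  linarith

/-- `(t³ − 1)^{-1/2}` is integrable on `(1, ∞)`: `≤ (t − 1)^{-1/2}` on `(1, 2]`, `≤ √2 · t^{-3/2}` on
`(2, ∞)` (same shape as the tree's `integrableOn_inv_sqrt_cube_sub_self_Ioi`). [folklore] -/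
theorem integrableOn_inv_sqrt_cube_sub_one_Ioi :
    IntegrableOn (fun t : ℝ => (Real.sqrt (t ^ 3 - 1))⁻¹) (Ioi 1) := by
  have hmeas : ∀ s : Set ℝ, s ⊆ Ioi 1 → MeasurableSet s →
      AEStronglyMeasurable (fun t : ℝ => (Real.sqrt (t ^ 3 - 1))⁻¹) (volume.restrict s) := by
    intro s hs hsm
    refine ContinuousOn.aestronglyMeasurable ?_ hsm
    refine ContinuousOn.inv₀ (by fun_prop) ?_
    intro x hx
    exact (Real.sqrt_pos.2 (cube_sub_one_pos (hs hx))).ne'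
  rw [← Ioc_union_Ioi_eq_Ioi (show (1 : ℝ) ≤ 2 by norm_num)]
  refine IntegrableOn.union ?_ ?_
  · have hint : IntegrableOn (fun x : ℝ => (x - 1) ^ (-(1 / 2 : ℝ))) (Ioc 1 2) := by
      have h := (intervalIntegral.intervalIntegrable_rpow' (a := 0) (b := 1)
        (r := -(1 / 2 : ℝ)) (by norm_num)).comp_sub_right 1
      have h' := (intervalIntegrable_iff_integrableOn_Ioc_of_le
        (show (0 : ℝ) + 1 ≤ 1 + 1 by norm_num)).1 h
      simpa [one_add_one_eq_two] using h'
    refine Integrable.mono' hint (hmeas _ Ioc_subset_Ioi_self measurableSet_Ioc) ?_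
    refine (ae_restrict_iff' measurableSet_Ioc).2 (Eventually.of_forall fun x hx => ?_)
    have hx1 : 0 < x - 1 := by linarith [hx.1]
    have hle : x - 1 ≤ x ^ 3 - 1 := sub_one_le_cube_sub_one hx.1.le
    rw [norm_inv, Real.norm_of_nonneg (Real.sqrt_nonneg _), Real.rpow_neg hx1.le,
      ← Real.sqrt_eq_rpow]
    exact inv_anti₀ (Real.sqrt_pos.2 hx1) (Real.sqrt_le_sqrt hle)
  · have hint : IntegrableOn (fun x : ℝ => Real.sqrt 2 * x ^ (-(3 / 2 : ℝ))) (Ioi 2) :=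
      (integrableOn_Ioi_rpow_of_lt (by norm_num) (by norm_num)).const_mul _
    refine Integrable.mono' hint
      (hmeas _ (Ioi_subset_Ioi (by norm_num)) measurableSet_Ioi) ?_
    refine (ae_restrict_iff' measurableSet_Ioi).2 (Eventually.of_forall fun x hx => ?_)
    have hx2 : (2 : ℝ) < x := hx
    have hx0 : 0 < x := by linarith
    have hle : x ^ 3 / 2 ≤ x ^ 3 - 1 := half_cube_le_cube_sub_one hx2.le
    have hpos : 0 < x ^ 3 / 2 := by positivity
    rw [norm_inv, Real.norm_of_nonneg (Real.sqrt_nonneg _)]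
    calc (Real.sqrt (x ^ 3 - 1))⁻¹ ≤ (Real.sqrt (x ^ 3 / 2))⁻¹ :=
          inv_anti₀ (Real.sqrt_pos.2 hpos) (Real.sqrt_le_sqrt hle)
      _ = Real.sqrt 2 * x ^ (-(3 / 2 : ℝ)) := by
          have hsq : Real.sqrt (x ^ 3) = x ^ (3 / 2 : ℝ) := by
            rw [Real.sqrt_eq_rpow, ← Real.rpow_natCast, ← Real.rpow_mul hx0.le]
            norm_num
          rw [Real.sqrt_div' _ zero_le_two, inv_div, Real.rpow_neg hx0.le, div_eq_mul_inv, hsq]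

/-- `ϖ₃ > 0`. [folklore] -/
theorem fermatPeriod_pos : 0 < fermatPeriod := by
  rw [fermatPeriod, setIntegral_pos_iff_support_of_nonneg_ae
    (Eventually.of_forall fun x => inv_nonneg.2 (Real.sqrt_nonneg _))
    integrableOn_inv_sqrt_cube_sub_one_Ioi]
  have hsub : Ioi (1 : ℝ) ⊆
      Function.support (fun t : ℝ => (Real.sqrt (t ^ 3 - 1))⁻¹) ∩ Ioi 1 := by
    intro x hx
    exact ⟨(inv_pos.2 (Real.sqrt_pos.2 (cube_sub_one_pos (mem_Ioi.1 hx)))).ne', hx⟩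
  calc (0 : ENNReal) < volume (Ioi (1 : ℝ)) := by simp
    _ ≤ _ := measure_mono hsub

/-- `{x³ − 1 > 0} = {x > 1}` in `ℝ¹`, as the preimage of `(1, ∞)` under `ℝ¹ ≃ ℝ`. [folklore] -/
theorem dom_fermat_eq : dom 0 (-1) = (MeasurableEquiv.funUnique (Fin 1) ℝ) ⁻¹' Ioi 1 := by
  ext x
  simp only [dom, Int.cast_zero, zero_mul, add_zero, Int.cast_neg, Int.cast_one, mem_setOf_eq,
    mem_preimage, mem_Ioi]
  have hq : 0 < x 0 ^ 2 + x 0 + 1 := by nlinarith [sq_nonneg (x 0 + 1 / 2)]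
  have hf : x 0 ^ 3 + -1 = (x 0 - 1) * (x 0 ^ 2 + x 0 + 1) := by ring
  change 0 < x 0 ^ 3 + -1 ↔ 1 < x default
  rw [Fin.default_eq_zero, hf]
  constructor
  · intro h
    by_contra hle
    push Not at hle
    have : (x 0 - 1) * (x 0 ^ 2 + x 0 + 1) ≤ 0 :=
      mul_nonpos_of_nonpos_of_nonneg (by linarith) hq.le
    linarith
  · intro h
    exact mul_pos (by linarith) hq

/-- The Fermat integrand factors through `ℝ¹ ≃ ℝ`. [folklore] -/
theorem integrand_fermat_eq (a : ℚ) :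
    integrand 0 (-1) a = (fun t : ℝ => (a : ℝ) * (Real.sqrt (t ^ 3 - 1))⁻¹) ∘
      (MeasurableEquiv.funUnique (Fin 1) ℝ) := by
  funext x
  simp only [integrand, Int.cast_zero, zero_mul, add_zero, Int.cast_neg, Int.cast_one,
    Function.comp_apply]
  rw [div_eq_mul_inv, ← sub_eq_add_neg]
  rfl

/-- `a/√(x³ − 1)` is integrable on `{x³ − 1 > 0}`. [folklore] -/
theorem integrableOn_integrand_fermat (a : ℚ) :
    IntegrableOn (integrand 0 (-1) a) (dom 0 (-1)) := by
  rw [dom_fermat_eq, integrand_fermat_eq]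
  exact ((volume_preserving_funUnique (Fin 1) ℝ).integrableOn_comp_preimage
    (MeasurableEquiv.measurableEmbedding _)).2
    (integrableOn_inv_sqrt_cube_sub_one_Ioi.const_mul (a : ℝ))

/-- **An explicit inhabitant of the crux's hypotheses**: `[{x³ − 1 > 0}, a/√(x³ − 1)]`, the
real-sector period representation of the Fermat cubic `y² = x³ − 1`, for any rational `a`. -/
def fermatRep (a : ℚ) : IntegralRep 1 where
  domain := dom 0 (-1)
  integrand := integrand 0 (-1) a
  isSemialgebraic_domain := isSemialgebraic_dom 0 (-1)
  isSemialgebraicFunOn_integrand := isSemialgebraicFunOn_integrand 0 (-1) a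
  integrableOn := integrableOn_integrand_fermat a

/-- The domain of `fermatRep a`. [folklore] -/
@[simp] theorem fermatRep_domain (a : ℚ) : (fermatRep a).domain = dom 0 (-1) := rfl

/-- The integrand of `fermatRep a`. [folklore] -/
@[simp] theorem fermatRep_integrand (a : ℚ) : (fermatRep a).integrand = integrand 0 (-1) a := rfl

/-- `value [{x³−1>0}, a/√(x³−1)] = a · ϖ₃`. [folklore] -/
theorem value_fermatRep (a : ℚ) : (fermatRep a).value = (a : ℝ) * fermatPeriod := by
  have h := (volume_preserving_funUnique (Fin 1) ℝ).setIntegral_preimage_emb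
    (MeasurableEquiv.measurableEmbedding _) (fun t : ℝ => (a : ℝ) * (Real.sqrt (t ^ 3 - 1))⁻¹)
    (Ioi 1)
  show ∫ x in (fermatRep a).domain, (fermatRep a).integrand x = _
  rw [fermatRep_domain, fermatRep_integrand, dom_fermat_eq, integrand_fermat_eq]
  simp only [Function.comp_apply] at h ⊢
  refine h.trans ?_
  rw [fermatPeriod, ← integral_const_mul]

/-- The hypotheses of the crux at `(A, B, a) = (0, −1, a)` hold for `fermatRep a` (by `rfl`). -/
theorem fermatRep_hyps (a : ℚ) :
    (fermatRep a).domain = {x | 0 < x 0 ^ 3 + ((0 : ℤ) : ℝ) * x 0 + ((-1 : ℤ) : ℝ)} ∧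
    EqOn (fermatRep a).integrand
      (fun x => (a : ℝ) / Real.sqrt (x 0 ^ 3 + ((0 : ℤ) : ℝ) * x 0 + ((-1 : ℤ) : ℝ)))
      (fermatRep a).domain :=
  ⟨rfl, fun _ _ => rfl⟩


end Summit.KontsevichZagierPeriods.IsogenyCertificates.RealPeriodSectorCompleteNegative
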